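import Literature.Barriers.CriticalPhenomena.SRWGreenHeatKernel1D
import Mathlib.Analysis.Complex.ExponentialBounds
import HarnessLib

/-!
# BalabanUVNodes ∕ N15 — THE KING-MODEL RUNG (PART Ϣ-a): THE ONE-DIMENSIONAL HEAT SYMBOL `e^{−σ(1−cos θ)}` —
# its first four `θ`-derivatives in closed form and the GAUSSIAN LOCALISATION OF THE FOURTH, `|∂_θ⁴e^{−σ(1−cos θ)}| ≤ (7σ + 21σ²)·e^{−(σ∕2)(1−cos θ)}`
# (the analytic input of PART Ϣ: the η-uniform power-law decay of King's `A = 0` covariance in four dimensions by heat-kernel subordination)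
# (Track A, DAG node N15 = NE2; FAN-OUT v1.1 §N15 s3 «KING-MODEL RUNG … + what the curved case adds»; count-neutral)

HONEST FRAMING.  Count-neutral (cell `pub-ymgap`, seat `pub-ymgap-dag-n15-e` g55; `--supports stmt-QuantumFields-27247 --as helper` = K3ᴬ, KEY MAP v3).  Elementary one-variable
calculus about the symbol `heat σ θ = e^{−σ(1−cos θ)}` of the rate-one continuous-time simple random walk on `ℤ` (the tree's `SRWGreen.heat`, `SRWGreen.hasDerivAt_heat`, cited by
name — NOT restated); no lattice, no torus, no field theory in this file.  WHY IT IS HERE: PART Ϣ proves `c·|(c(−Δ)+m²)⁻¹(x,y)| ≤ C₀∕(1+‖x−y‖²_∞) + 8c∕(m²K₀⁴)` on the cubic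
four-torus (King's covariance (2.13)∕(4.4) at `A = 0`, η-uniform at King's scaling `c = L²`) by SUBORDINATION `lapSym⁻¹ = ∫₀^∞e^{−t·lapSym}dt` and FACTORISATION of the plane-wave
sum into one-dimensional CYCLE heat kernels `K⁻¹Σ_k e^{−s(2−2cos(2πk∕K))}e^{2πikn∕K} = K⁻¹Σ_k heat(2s)(2πk∕K)·e^{2πikn∕K}`; the decay of the cycle kernel in `n` comes from FOUR
summations by parts, i.e. from fourth differences of `θ ↦ heat σ θ` at step `2π∕K`, bounded by `(2π∕K)⁴·sup|∂_θ⁴heat|` — and the fourth derivative must be bounded WITH its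
Gaussian localisation `e^{−(σ∕2)(1−cos θ)}` (a bound by `C(σ+σ²)` alone loses a factor `√s` in the time integral and gives only `1∕|x−y|`).
CONTENTS.  §1 the closed forms `kingHeatD1 … kingHeatD4` (`∂^jheat = P_j(σ, sin θ, cos θ)·heat`, `P₁ = −σ sin`, `P₂ = −σcos + σ²sin²`, `P₃ = σ sin + 3σ²sin cos − σ³sin³`,
`P₄ = σcos + 3σ²cos² − 4σ²sin² − 6σ³sin²cos + σ⁴sin⁴`) and the derivative chain ★ `hasDerivAt_heat_D1`, `hasDerivAt_kingHeatD1`, `hasDerivAt_kingHeatD2`, `hasDerivAt_kingHeatD3`; the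
chain as one family `kingHeatChain σ : ℕ → ℝ → ℝ` with ★ `hasDerivAt_kingHeatChain` (`i < 4`); `2π`-periodicity of every member; §2 the elementary supremum
`x²e^{−bx} ≤ 4∕(e²b²)` (from Mathlib `Real.mul_exp_neg_le_exp_neg_one`) and `e⁻² < 9∕64`; §3 ★★ **`abs_kingHeatD4_le`**: `|kingHeatD4 σ θ| ≤ (7σ + 21σ²)·exp(−(σ∕2)(1 − cos θ))` for `σ ≥ 0` (with `Y = 1 − cos θ`: `sin²θ = Y(2−Y) ≤ 2Y`,
`Y^je^{−σY} = Y^je^{−σY∕2}·e^{−σY∕2}`, and `16∕e ≤ 6`, `24∕e ≤ 9`, `64∕e² ≤ 9`), ★ `abs_kingHeatChain_four_le`.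
PRIOR TREE ART (by name, not restated): `Literature.Barriers.CriticalPhenomena.SRWGreen.heat` ∕ `hasDerivAt_heat` ∕ `heat_le_one` ∕ `heat_pos` ∕ `heat_periodic` ∕ `u₃`
(`SRWGreenHeatKernel1D`, `SRWGreenSymbolCalculus`: the tree's graded symbol calculus gives `∂^Nheat = heat·P_N` with EXISTENTIAL constants for `s ≥ 1`; this file needs the one explicit
`N = 4` bound for all `σ ≥ 0`, so it computes `P₄` by hand).  Mathlib: `Real.mul_exp_neg_le_exp_neg_one`, `Real.exp_neg_one_lt_d9`.
Dedup (rg at filing): basename 0 files; needles `kingHeatD1|kingHeatD4|kingHeatChain|abs_kingHeatD4_le|hasDerivAt_mul_heat|heat_le_exp_half|sq_mul_exp_neg_mul_le_inv_e_sq_div|exp_neg_two_lt_nine_div` 0 tree files; preflight v1 `dedup.landed` ×2 fixed before filing (`e⁻¹ < 3∕8` ≡ a BalabanUV∕Beta lemma — now an inline `have` from Mathlib `Real.exp_neg_one_lt_d9`; `x·e^{−bx} ≤ e⁻¹∕b` ≡ `T4JointInsertionProfile.mul_exp_neg_mul_le` — the T4 tower is not imported into PART Ϣ; the one-liner is Mathlib's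 `Real.mul_exp_neg_le_exp_neg_one`).
Locators: [King1986] (2.13) p.653, (4.4) p.670 (the symbol `2−2cos` of `−Δ`); [LawlerLimic2010] §2.3 (characteristic-function approach to the LCLT) for the method; the
inequalities themselves are [folklore].  0 `sorry`; 5 `def` (`kingHeatD1`–`kingHeatD4`, `kingHeatChain`).
-/

noncomputable section

open Real Set

namespace Summit.QuantumFields.YangMills.BalabanUVNodes.N15KingModelRung.HeatKernel

open Literature.Barriers.CriticalPhenomena.SRWGreen (heat hasDerivAt_heat heat_le_one heat_pos u₃)

/-! ## §1 The first four derivatives of the heat symbol in closed form -/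

/-- `∂_θ heat = −σ sin θ · heat`. [folklore] -/
def kingHeatD1 (σ θ : ℝ) : ℝ := (-(σ * Real.sin θ)) * heat σ θ

/-- `∂_θ² heat = (−σ cos θ + σ² sin²θ) · heat`. [folklore] -/
def kingHeatD2 (σ θ : ℝ) : ℝ := (-(σ * Real.cos θ) + σ ^ 2 * Real.sin θ ^ 2) * heat σ θ

/-- `∂_θ³ heat = (σ sin θ + 3σ² sin θ cos θ − σ³ sin³θ) · heat`. [folklore] -/
def kingHeatD3 (σ θ : ℝ) : ℝ := (σ * Real.sin θ + 3 * σ ^ 2 * Real.sin θ * Real.cos θ - σ ^ 3 * Real.sin θ ^ 3) * heat σ θ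

/-- `∂_θ⁴ heat = (σ cos θ + 3σ² cos²θ − 4σ² sin²θ − 6σ³ sin²θ cos θ + σ⁴ sin⁴θ) · heat`. [folklore] -/
def kingHeatD4 (σ θ : ℝ) : ℝ :=
  (σ * Real.cos θ + 3 * σ ^ 2 * Real.cos θ ^ 2 - 4 * σ ^ 2 * Real.sin θ ^ 2 - 6 * σ ^ 3 * Real.sin θ ^ 2 * Real.cos θ + σ ^ 4 * Real.sin θ ^ 4) * heat σ θ

/-- The derivative chain of the heat symbol as one family: `kingHeatChain σ 0 = heat σ`, `kingHeatChain σ j = kingHeatDj σ` (`j = 1…4`), and `0` beyond (unused). [folklore] -/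
def kingHeatChain (σ : ℝ) : ℕ → ℝ → ℝ
  | 0 => heat σ
  | 1 => kingHeatD1 σ
  | 2 => kingHeatD2 σ
  | 3 => kingHeatD3 σ
  | 4 => kingHeatD4 σ
  | _ => fun _ => 0

/-- The product rule along the chain: if `P′ = Q` then `(P·heat)′ = (Q − σ sin θ·P)·heat`. [folklore] -/
theorem hasDerivAt_mul_heat {σ : ℝ} {P : ℝ → ℝ} {Q : ℝ} {θ : ℝ} (hP : HasDerivAt P Q θ) :
    HasDerivAt (fun x => P x * heat σ x) ((Q - σ * Real.sin θ * P θ) * heat σ θ) θ := by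
  have h := hP.mul (hasDerivAt_heat σ θ)
  have e : Q * heat σ θ + P θ * (heat σ θ * -(σ * u₃ θ)) = (Q - σ * Real.sin θ * P θ) * heat σ θ := by
    unfold u₃; ring
  rw [e] at h
  exact h

/-- ★ `∂_θ heat σ = kingHeatD1 σ` (the tree's `hasDerivAt_heat`, `u₃ = sin`). [folklore] -/
theorem hasDerivAt_heat_D1 (σ θ : ℝ) : HasDerivAt (heat σ) (kingHeatD1 σ θ) θ := by
  have h := hasDerivAt_heat σ θ
  have e : heat σ θ * -(σ * u₃ θ) = kingHeatD1 σ θ := by unfold kingHeatD1 u₃; ring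
  rw [e] at h
  exact h

/-- ★ `∂_θ kingHeatD1 σ = kingHeatD2 σ`. [folklore] -/
theorem hasDerivAt_kingHeatD1 (σ θ : ℝ) : HasDerivAt (kingHeatD1 σ) (kingHeatD2 σ θ) θ := by
  have hP : HasDerivAt (fun x => -(σ * Real.sin x)) (-(σ * Real.cos θ)) θ := ((Real.hasDerivAt_sin θ).const_mul σ).neg
  have h := hasDerivAt_mul_heat (σ := σ) hP
  have e : (-(σ * Real.cos θ) - σ * Real.sin θ * -(σ * Real.sin θ)) * heat σ θ = kingHeatD2 σ θ := by unfold kingHeatD2; ring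
  rw [e] at h
  exact h

/-- ★ `∂_θ kingHeatD2 σ = kingHeatD3 σ`. [folklore] -/
theorem hasDerivAt_kingHeatD2 (σ θ : ℝ) : HasDerivAt (kingHeatD2 σ) (kingHeatD3 σ θ) θ := by
  have hP : HasDerivAt (fun x => -(σ * Real.cos x) + σ ^ 2 * Real.sin x ^ 2)
      (-(σ * -Real.sin θ) + σ ^ 2 * (2 * Real.sin θ ^ 1 * Real.cos θ)) θ :=
    ((Real.hasDerivAt_cos θ).const_mul σ).neg.add (((Real.hasDerivAt_sin θ).pow 2).const_mul (σ ^ 2))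
  have h := hasDerivAt_mul_heat (σ := σ) hP
  have e : (-(σ * -Real.sin θ) + σ ^ 2 * (2 * Real.sin θ ^ 1 * Real.cos θ) - σ * Real.sin θ * (-(σ * Real.cos θ) + σ ^ 2 * Real.sin θ ^ 2)) * heat σ θ
      = kingHeatD3 σ θ := by unfold kingHeatD3; ring
  rw [e] at h
  exact h

/-- ★ `∂_θ kingHeatD3 σ = kingHeatD4 σ`. [folklore] -/
theorem hasDerivAt_kingHeatD3 (σ θ : ℝ) : HasDerivAt (kingHeatD3 σ) (kingHeatD4 σ θ) θ := by
  have h1 : HasDerivAt (fun x => σ * Real.sin x) (σ * Real.cos θ) θ := (Real.hasDerivAt_sin θ).const_mul σ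
  have h2 : HasDerivAt (fun x => 3 * σ ^ 2 * Real.sin x * Real.cos x) (3 * σ ^ 2 * Real.cos θ * Real.cos θ + 3 * σ ^ 2 * Real.sin θ * -Real.sin θ) θ :=
    ((Real.hasDerivAt_sin θ).const_mul (3 * σ ^ 2)).mul (Real.hasDerivAt_cos θ)
  have h3 : HasDerivAt (fun x => σ ^ 3 * Real.sin x ^ 3) (σ ^ 3 * (3 * Real.sin θ ^ 2 * Real.cos θ)) θ :=
    ((Real.hasDerivAt_sin θ).pow 3).const_mul (σ ^ 3)
  have hP : HasDerivAt (fun x => σ * Real.sin x + 3 * σ ^ 2 * Real.sin x * Real.cos x - σ ^ 3 * Real.sin x ^ 3)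
      (σ * Real.cos θ + (3 * σ ^ 2 * Real.cos θ * Real.cos θ + 3 * σ ^ 2 * Real.sin θ * -Real.sin θ) - σ ^ 3 * (3 * Real.sin θ ^ 2 * Real.cos θ)) θ :=
    (h1.add h2).sub h3
  have h := hasDerivAt_mul_heat (σ := σ) hP
  have e : (σ * Real.cos θ + (3 * σ ^ 2 * Real.cos θ * Real.cos θ + 3 * σ ^ 2 * Real.sin θ * -Real.sin θ) - σ ^ 3 * (3 * Real.sin θ ^ 2 * Real.cos θ)
        - σ * Real.sin θ * (σ * Real.sin θ + 3 * σ ^ 2 * Real.sin θ * Real.cos θ - σ ^ 3 * Real.sin θ ^ 3)) * heat σ θ = kingHeatD4 σ θ := by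
    unfold kingHeatD4; ring
  rw [e] at h
  exact h

/-- ★ THE CHAIN: `∂_θ kingHeatChain σ i = kingHeatChain σ (i+1)` for `i < 4`. [folklore] -/
theorem hasDerivAt_kingHeatChain (σ : ℝ) {i : ℕ} (hi : i < 4) (θ : ℝ) : HasDerivAt (kingHeatChain σ i) (kingHeatChain σ (i + 1) θ) θ := by
  match i, hi with
  | 0, _ => exact hasDerivAt_heat_D1 σ θ
  | 1, _ => exact hasDerivAt_kingHeatD1 σ θ
  | 2, _ => exact hasDerivAt_kingHeatD2 σ θ
  | 3, _ => exact hasDerivAt_kingHeatD3 σ θ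
  | (n + 4), h => omega

/-- `kingHeatChain σ 0 = heat σ`. [folklore] -/
@[simp] theorem kingHeatChain_zero (σ : ℝ) : kingHeatChain σ 0 = heat σ := rfl

/-- `kingHeatChain σ 4 = kingHeatD4 σ`. [folklore] -/
@[simp] theorem kingHeatChain_four (σ : ℝ) : kingHeatChain σ 4 = kingHeatD4 σ := rfl

/-! ### `2π`-periodicity of every member of the chain -/

/-- `heat σ (θ + 2π) = heat σ θ`. [folklore] -/
theorem heat_add_two_pi (σ θ : ℝ) : heat σ (θ + 2 * π) = heat σ θ := by
  unfold heat; rw [Real.cos_add_two_pi]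

/-- `kingHeatD4 σ (θ + 2π) = kingHeatD4 σ θ`. [folklore] -/
theorem kingHeatD4_add_two_pi (σ θ : ℝ) : kingHeatD4 σ (θ + 2 * π) = kingHeatD4 σ θ := by
  unfold kingHeatD4; rw [Real.cos_add_two_pi, Real.sin_add_two_pi, heat_add_two_pi]

/-- Every member of the chain is `2π`-periodic. [folklore] -/
theorem kingHeatChain_add_two_pi (σ : ℝ) (i : ℕ) (θ : ℝ) : kingHeatChain σ i (θ + 2 * π) = kingHeatChain σ i θ := by
  match i with
  | 0 => exact heat_add_two_pi σ θ
  | 1 => simp only [kingHeatChain, kingHeatD1, Real.sin_add_two_pi, heat_add_two_pi]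
  | 2 => simp only [kingHeatChain, kingHeatD2, Real.sin_add_two_pi, Real.cos_add_two_pi, heat_add_two_pi]
  | 3 => simp only [kingHeatChain, kingHeatD3, Real.sin_add_two_pi, Real.cos_add_two_pi, heat_add_two_pi]
  | 4 => exact kingHeatD4_add_two_pi σ θ
  | (n + 5) => rfl

/-- Periodicity under integer multiples of `2π`. [folklore] -/
theorem kingHeatChain_add_int_mul_two_pi (σ : ℝ) (i : ℕ) (θ : ℝ) (m : ℤ) : kingHeatChain σ i (θ + m * (2 * π)) = kingHeatChain σ i θ := by
  have hper : Function.Periodic (kingHeatChain σ i) (2 * π) := fun x => kingHeatChain_add_two_pi σ i x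
  exact hper.int_mul m θ

/-! ## §2 One elementary supremum and `e⁻² < 9∕64` -/

/-- `x²·e^{−bx} ≤ 4e⁻²∕b²` for `b > 0`, `x ≥ 0` (square the previous one at `b∕2`). [folklore] -/
theorem sq_mul_exp_neg_mul_le_inv_e_sq_div {b : ℝ} (hb : 0 < b) {x : ℝ} (hx : 0 ≤ x) : x ^ 2 * Real.exp (-(b * x)) ≤ 4 * Real.exp (-2) / b ^ 2 := by
  have hb2 : 0 < b / 2 := by positivity
  -- `x·e^{−(b∕2)x} ≤ e⁻¹∕(b∕2)` (Mathlib `Real.mul_exp_neg_le_exp_neg_one`; the rescaled statement is the tree's `T4JointInsertionProfile.mul_exp_neg_mul_le`, cited, not imported)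
  have h : x * Real.exp (-(b / 2 * x)) ≤ Real.exp (-1) / (b / 2) := by
    rw [le_div_iff₀ hb2]
    calc x * Real.exp (-(b / 2 * x)) * (b / 2) = b / 2 * x * Real.exp (-(b / 2 * x)) := by ring
      _ ≤ Real.exp (-1) := Real.mul_exp_neg_le_exp_neg_one (b / 2 * x)
  have hpos : 0 ≤ x * Real.exp (-(b / 2 * x)) := mul_nonneg hx (Real.exp_pos _).le
  have hsq := mul_self_le_mul_self hpos h
  have e1 : x * Real.exp (-(b / 2 * x)) * (x * Real.exp (-(b / 2 * x))) = x ^ 2 * Real.exp (-(b * x)) := by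
    rw [show x ^ 2 * Real.exp (-(b * x)) = x * x * (Real.exp (-(b / 2 * x)) * Real.exp (-(b / 2 * x))) by
      rw [← Real.exp_add]; ring_nf]
    ring
  have e2 : Real.exp (-1) / (b / 2) * (Real.exp (-1) / (b / 2)) = 4 * Real.exp (-2) / b ^ 2 := by
    rw [show Real.exp (-2) = Real.exp (-1) * Real.exp (-1) by rw [← Real.exp_add]; norm_num]
    field_simp
    ring
  rw [e1, e2] at hsq
  exact hsq

/-- `e⁻² < 9∕64` (`e⁻¹ < 0.3679 < 3∕8`, Mathlib `Real.exp_neg_one_lt_d9`). [folklore] -/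
theorem exp_neg_two_lt_nine_div : Real.exp (-2) < 9 / 64 := by
  have h : Real.exp (-1) < 3 / 8 := lt_trans Real.exp_neg_one_lt_d9 (by norm_num)
  have h0 : 0 < Real.exp (-1) := Real.exp_pos _
  rw [show Real.exp (-2) = Real.exp (-1) * Real.exp (-1) by rw [← Real.exp_add]; norm_num]
  nlinarith

/-! ## §3 The Gaussian localisation of the fourth derivative -/

/-- `sin²θ ≤ 2(1 − cos θ)` (`sin² = (1−cos)(1+cos)`). [folklore] -/
theorem sin_sq_le_two_mul_one_sub_cos (θ : ℝ) : Real.sin θ ^ 2 ≤ 2 * (1 - Real.cos θ) := by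
  have h : Real.sin θ ^ 2 = (1 - Real.cos θ) * (1 + Real.cos θ) := by nlinarith [Real.sin_sq_add_cos_sq θ]
  rw [h]
  have h1 : 0 ≤ 1 - Real.cos θ := by linarith [Real.cos_le_one θ]
  nlinarith [Real.cos_le_one θ]

/-- `heat σ θ = e^{−σY∕2}·e^{−σY∕2}` with `Y = 1 − cos θ`. [folklore] -/
theorem heat_eq_half_mul_half (σ θ : ℝ) :
    heat σ θ = Real.exp (-(σ / 2 * (1 - Real.cos θ))) * Real.exp (-(σ / 2 * (1 - Real.cos θ))) := by
  unfold heat; rw [← Real.exp_add]; ring_nf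

/-- `heat σ θ ≤ e^{−(σ∕2)(1−cos θ)}` for `σ ≥ 0`. [folklore] -/
theorem heat_le_exp_half {σ : ℝ} (hσ : 0 ≤ σ) (θ : ℝ) : heat σ θ ≤ Real.exp (-(σ / 2 * (1 - Real.cos θ))) := by
  rw [heat_eq_half_mul_half]
  have h1 : Real.exp (-(σ / 2 * (1 - Real.cos θ))) ≤ 1 := by
    rw [Real.exp_le_one_iff, neg_nonpos]
    exact mul_nonneg (by positivity) (by linarith [Real.cos_le_one θ])
  have h0 : 0 ≤ Real.exp (-(σ / 2 * (1 - Real.cos θ))) := (Real.exp_pos _).le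
  calc _ ≤ 1 * Real.exp (-(σ / 2 * (1 - Real.cos θ))) := mul_le_mul_of_nonneg_right h1 h0
    _ = _ := one_mul _

/-- `(1−cos θ)·heat σ θ ≤ (2e⁻¹∕σ)·e^{−(σ∕2)(1−cos θ)}` for `σ > 0` (`Y·e^{−σY∕2} ≤ 2e⁻¹∕σ`, Mathlib `Real.mul_exp_neg_le_exp_neg_one`; cf. the tree's
`T4JointInsertionProfile.mul_exp_neg_mul_le`, cited, not imported). [folklore] -/
theorem one_sub_cos_mul_heat_le {σ : ℝ} (hσ : 0 < σ) (θ : ℝ) :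
    (1 - Real.cos θ) * heat σ θ ≤ 2 * Real.exp (-1) / σ * Real.exp (-(σ / 2 * (1 - Real.cos θ))) := by
  rw [heat_eq_half_mul_half, ← mul_assoc]
  have h : (1 - Real.cos θ) * Real.exp (-(σ / 2 * (1 - Real.cos θ))) ≤ 2 * Real.exp (-1) / σ := by
    rw [le_div_iff₀ hσ]
    calc (1 - Real.cos θ) * Real.exp (-(σ / 2 * (1 - Real.cos θ))) * σ
        = 2 * (σ / 2 * (1 - Real.cos θ) * Real.exp (-(σ / 2 * (1 - Real.cos θ)))) := by ring
      _ ≤ 2 * Real.exp (-1) := by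
          have := Real.mul_exp_neg_le_exp_neg_one (σ / 2 * (1 - Real.cos θ)); linarith
  exact mul_le_mul_of_nonneg_right h (Real.exp_pos _).le

/-- `(1−cos θ)²·heat σ θ ≤ (16e⁻²∕σ²)·e^{−(σ∕2)(1−cos θ)}` for `σ > 0`. [folklore] -/
theorem one_sub_cos_sq_mul_heat_le {σ : ℝ} (hσ : 0 < σ) (θ : ℝ) :
    (1 - Real.cos θ) ^ 2 * heat σ θ ≤ 16 * Real.exp (-2) / σ ^ 2 * Real.exp (-(σ / 2 * (1 - Real.cos θ))) := by
  rw [heat_eq_half_mul_half, ← mul_assoc]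
  have h := sq_mul_exp_neg_mul_le_inv_e_sq_div (b := σ / 2) (by positivity) (x := 1 - Real.cos θ) (by linarith [Real.cos_le_one θ])
  have e : 4 * Real.exp (-2) / (σ / 2) ^ 2 = 16 * Real.exp (-2) / σ ^ 2 := by field_simp; ring
  rw [e] at h
  exact mul_le_mul_of_nonneg_right h (Real.exp_pos _).le

/-- ★★ **THE GAUSSIAN LOCALISATION OF THE FOURTH DERIVATIVE**: `|∂_θ⁴e^{−σ(1−cos θ)}| = |kingHeatD4 σ θ| ≤ (7σ + 21σ²)·e^{−(σ∕2)(1−cos θ)}` for every `σ ≥ 0`, `θ ∈ ℝ` — term by term: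
`σ|cos|heat ≤ σ`, `3σ²cos²heat ≤ 3σ²`, `4σ²sin²heat ≤ 8σ²(1−cos)heat ≤ (16∕e)σ ≤ 6σ`, `6σ³sin²|cos|heat ≤ 12σ³(1−cos)heat ≤ (24∕e)σ² ≤ 9σ²`, `σ⁴sin⁴heat ≤ 4σ⁴(1−cos)²heat ≤ (64∕e²)σ² ≤ 9σ²`,
each against the half Gaussian `e^{−(σ∕2)(1−cos θ)}`. [folklore] -/
theorem abs_kingHeatD4_le {σ : ℝ} (hσ : 0 ≤ σ) (θ : ℝ) : |kingHeatD4 σ θ| ≤ (7 * σ + 21 * σ ^ 2) * Real.exp (-(σ / 2 * (1 - Real.cos θ))) := by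
  set E := Real.exp (-(σ / 2 * (1 - Real.cos θ))) with hE
  have hE0 : 0 < E := Real.exp_pos _
  have hg0 : 0 < heat σ θ := heat_pos σ θ
  have hgE : heat σ θ ≤ E := heat_le_exp_half hσ θ
  have hc1 : |Real.cos θ| ≤ 1 := Real.abs_cos_le_one θ
  have hs1 : |Real.sin θ| ≤ 1 := Real.abs_sin_le_one θ
  have hY0 : 0 ≤ 1 - Real.cos θ := by linarith [Real.cos_le_one θ]
  have hsin2 : Real.sin θ ^ 2 ≤ 2 * (1 - Real.cos θ) := sin_sq_le_two_mul_one_sub_cos θ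
  rcases hσ.eq_or_lt with h0 | hpos
  · -- σ = 0: everything vanishes
    subst h0
    simp [kingHeatD4]
  have he1 : Real.exp (-1) < 3 / 8 := lt_trans Real.exp_neg_one_lt_d9 (by norm_num)
  have he2 := exp_neg_two_lt_nine_div
  -- the five terms
  have t1 : |σ * Real.cos θ * heat σ θ| ≤ σ * E := by
    rw [abs_mul, abs_mul, abs_of_pos hpos, abs_of_pos hg0]
    calc σ * |Real.cos θ| * heat σ θ ≤ σ * 1 * E := by gcongr
      _ = σ * E := by ring
  have t2 : |3 * σ ^ 2 * Real.cos θ ^ 2 * heat σ θ| ≤ 3 * σ ^ 2 * E := by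
    rw [abs_mul, abs_of_pos hg0, abs_mul, abs_of_pos (by positivity : (0:ℝ) < 3 * σ ^ 2), abs_pow, sq_abs]
    have hc2 : Real.cos θ ^ 2 ≤ 1 := by nlinarith [Real.sin_sq_add_cos_sq θ]
    calc 3 * σ ^ 2 * Real.cos θ ^ 2 * heat σ θ ≤ 3 * σ ^ 2 * 1 * E := by gcongr
      _ = 3 * σ ^ 2 * E := by ring
  have t3 : |4 * σ ^ 2 * Real.sin θ ^ 2 * heat σ θ| ≤ 6 * σ * E := by
    rw [abs_mul, abs_of_pos hg0, abs_of_nonneg (by positivity)]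
    have h := one_sub_cos_mul_heat_le hpos θ
    calc 4 * σ ^ 2 * Real.sin θ ^ 2 * heat σ θ ≤ 4 * σ ^ 2 * (2 * (1 - Real.cos θ)) * heat σ θ := by gcongr
      _ = 8 * σ ^ 2 * ((1 - Real.cos θ) * heat σ θ) := by ring
      _ ≤ 8 * σ ^ 2 * (2 * Real.exp (-1) / σ * E) := by gcongr
      _ = 16 * Real.exp (-1) * σ * E := by field_simp; ring
      _ ≤ 6 * σ * E := by nlinarith [mul_pos hpos hE0]
  have t4 : |6 * σ ^ 3 * Real.sin θ ^ 2 * Real.cos θ * heat σ θ| ≤ 9 * σ ^ 2 * E := by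
    rw [abs_mul, abs_of_pos hg0, abs_mul, abs_of_nonneg (by positivity : (0:ℝ) ≤ 6 * σ ^ 3 * Real.sin θ ^ 2)]
    have h := one_sub_cos_mul_heat_le hpos θ
    calc 6 * σ ^ 3 * Real.sin θ ^ 2 * |Real.cos θ| * heat σ θ ≤ 6 * σ ^ 3 * (2 * (1 - Real.cos θ)) * 1 * heat σ θ := by gcongr
      _ = 12 * σ ^ 3 * ((1 - Real.cos θ) * heat σ θ) := by ring
      _ ≤ 12 * σ ^ 3 * (2 * Real.exp (-1) / σ * E) := by gcongr
      _ = 24 * Real.exp (-1) * σ ^ 2 * E := by field_simp; ring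
      _ ≤ 9 * σ ^ 2 * E := by nlinarith [mul_pos (pow_pos hpos 2) hE0]
  have t5 : |σ ^ 4 * Real.sin θ ^ 4 * heat σ θ| ≤ 9 * σ ^ 2 * E := by
    rw [abs_mul, abs_of_pos hg0, abs_of_nonneg (by positivity)]
    have h := one_sub_cos_sq_mul_heat_le hpos θ
    have hs4 : Real.sin θ ^ 4 ≤ (2 * (1 - Real.cos θ)) ^ 2 := by
      rw [show Real.sin θ ^ 4 = (Real.sin θ ^ 2) ^ 2 by ring]
      exact pow_le_pow_left₀ (sq_nonneg _) hsin2 2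
    calc σ ^ 4 * Real.sin θ ^ 4 * heat σ θ ≤ σ ^ 4 * (2 * (1 - Real.cos θ)) ^ 2 * heat σ θ := by gcongr
      _ = 4 * σ ^ 4 * ((1 - Real.cos θ) ^ 2 * heat σ θ) := by ring
      _ ≤ 4 * σ ^ 4 * (16 * Real.exp (-2) / σ ^ 2 * E) := by gcongr
      _ = 64 * Real.exp (-2) * σ ^ 2 * E := by field_simp; ring
      _ ≤ 9 * σ ^ 2 * E := by nlinarith [mul_pos (pow_pos hpos 2) hE0]
  -- assemble
  have hsplit : kingHeatD4 σ θ = σ * Real.cos θ * heat σ θ + 3 * σ ^ 2 * Real.cos θ ^ 2 * heat σ θ - 4 * σ ^ 2 * Real.sin θ ^ 2 * heat σ θ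
      - 6 * σ ^ 3 * Real.sin θ ^ 2 * Real.cos θ * heat σ θ + σ ^ 4 * Real.sin θ ^ 4 * heat σ θ := by
    unfold kingHeatD4; ring
  rw [hsplit]
  have step := abs_add_le (σ * Real.cos θ * heat σ θ + 3 * σ ^ 2 * Real.cos θ ^ 2 * heat σ θ - 4 * σ ^ 2 * Real.sin θ ^ 2 * heat σ θ
      - 6 * σ ^ 3 * Real.sin θ ^ 2 * Real.cos θ * heat σ θ) (σ ^ 4 * Real.sin θ ^ 4 * heat σ θ)
  have step2 := abs_sub (σ * Real.cos θ * heat σ θ + 3 * σ ^ 2 * Real.cos θ ^ 2 * heat σ θ - 4 * σ ^ 2 * Real.sin θ ^ 2 * heat σ θ)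
      (6 * σ ^ 3 * Real.sin θ ^ 2 * Real.cos θ * heat σ θ)
  have step3 := abs_sub (σ * Real.cos θ * heat σ θ + 3 * σ ^ 2 * Real.cos θ ^ 2 * heat σ θ) (4 * σ ^ 2 * Real.sin θ ^ 2 * heat σ θ)
  have step4 := abs_add_le (σ * Real.cos θ * heat σ θ) (3 * σ ^ 2 * Real.cos θ ^ 2 * heat σ θ)
  nlinarith [t1, t2, t3, t4, t5, step, step2, step3, step4, hE0]

/-- ★ The same bound for the chain's top member: `|kingHeatChain σ 4 θ| ≤ (7σ + 21σ²)·e^{−(σ∕2)(1−cos θ)}`. [folklore] -/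
theorem abs_kingHeatChain_four_le {σ : ℝ} (hσ : 0 ≤ σ) (θ : ℝ) : |kingHeatChain σ 4 θ| ≤ (7 * σ + 21 * σ ^ 2) * Real.exp (-(σ / 2 * (1 - Real.cos θ))) :=
  abs_kingHeatD4_le hσ θ

/-- The crude corollary without the localisation: `|kingHeatD4 σ θ| ≤ 7σ + 21σ²`. [folklore] -/
theorem abs_kingHeatD4_le_crude {σ : ℝ} (hσ : 0 ≤ σ) (θ : ℝ) : |kingHeatD4 σ θ| ≤ 7 * σ + 21 * σ ^ 2 := by
  refine (abs_kingHeatD4_le hσ θ).trans ?_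
  have h1 : Real.exp (-(σ / 2 * (1 - Real.cos θ))) ≤ 1 := by
    rw [Real.exp_le_one_iff, neg_nonpos]; exact mul_nonneg (by positivity) (by linarith [Real.cos_le_one θ])
  have h0 : 0 ≤ 7 * σ + 21 * σ ^ 2 := by positivity
  calc (7 * σ + 21 * σ ^ 2) * Real.exp (-(σ / 2 * (1 - Real.cos θ))) ≤ (7 * σ + 21 * σ ^ 2) * 1 := mul_le_mul_of_nonneg_left h1 h0
    _ = _ := mul_one _

end Summit.QuantumFields.YangMills.BalabanUVNodes.N15KingModelRung.HeatKernel

end
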